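import Summits.FinalStateConjecture.FinalStateConjecture.Theorems.BulkKerrCapture.Negative.PointwiseVsUniform
import Summits.FinalStateConjecture.FinalStateConjecture.Theorems.NearExtremalKappaCapture.Negative.ExponentMonotonicity
import Summits.FinalStateConjecture.FinalStateConjecture.Theorems.PhaseMixingCaptureCaptureSufficesReduction
import HarnessLib

/-!
# `BulkKerrCaptureC2` from the all-orders Hintz claim (line `all-orders-lebesgue-port`)

Crux `stmt-FinalStateConjecture-14985`
(`Summit.FinalStateConjecture.FinalStateConjecture.Theses.PhaseMixingCapture.BulkKerrCaptureC2`, rank 4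
of `route-FinalStateConjecture-PhaseMixingCapture`; typing ruling 2026-08-16: the import-grade successor
of `BulkKerrCapture` with the convergence order handed over, `k = 2`), line lead
`prover-line-stmt-FinalStateConjecture-14985-0`, line `SketchStandalone` = idea `all-orders-lebesgue-port`
(ideator 2, `Cruxes/BulkKerrCaptureC2/SketchIdeator2.lean`), registered stub
`stub_c2Far_of_allOrdersBody` of the skeleton `Cruxes/BulkKerrCaptureC2/Lines/SketchStandalone.lean`.

**Statement.** HYPOTHESIS: VERBATIM the body of the Literature claim
`Literature.Geometry.Lorentzian.hintz_kerr_stability_subextremal_cauchy_allOrders` (Hintz,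
arXiv:2606.28253v2, Thm. 1.1 / Thm. 13.1 with (13.2) and Remarks 13.2–13.3, Cauchy consequence form
locally uniform in the centre, convergence in `Cᵏ` for EVERY `k`; `@[claim "Hintz2026" "under-review"]`,
re-vendoring wi-30700, p88775) — around every normalised sub-extremal centre `χ₀ ∈ (−1, 1)` and
normalised inner radius `ρ₀` between the unit-mass horizons there are exponents `(s, δ)` and a spin
radius `ς > 0`, and per mass `M > 0` and tolerance `η > 0` ONE basin `ε > 0`, serving every spin `a`
with `|a/M − χ₀| < ς` at `r₀ = ρ₀ M`. (The body and not the name only because the farm's olean of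
`KerrStabilitySubextremalCauchy` still predates p88775 at the time of writing; the by-name corollary is
appended to this file once it is served — the named claim unfolds to this hypothesis definitionally.)
CONCLUSION: the route decl `BulkKerrCaptureC2` BY NAME — for every `a₁ < 1` one `(s, δ)` and, per
`(M, η)`, one `ε` serve EVERY spin `|a| ≤ a₁ M` at the leaf `r₀ = M`: b-conormal vacuum data `ε`-close
to `Kerr.data M a M` have all maximal vacuum Cauchy developments far-complete (sojourn form, inlined),
with a region converging in `C²` to a sub-extremal `g_{M',a'}`, `|M' − M| + |a' − a| ≤ η`. The theorem
is CONDITIONAL on Hintz's unrefereed claim (its hypothesis); it closes the crux only modulo that claim.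

**Proof** (the landed Lebesgue-number pattern of `PhaseMixingCaptureBulkKerrCaptureFaithfulOfClaim`,
p77821, re-run with `k` instantiated at `2` instead of minimised). The tree lemma
`PhaseMixingCaptureCaptureSuffices.bulkKerrCaptureC2_iff` unfolds the inlined sojourn clause to
`DataEmbedding.HasCompleteFutureNullInfinityFar` (`Negative.range_farSliceIncl`). For `a₁ < 0` the spin range is empty (`Negative.no_spin_of_neg`).
Otherwise the compact segment `K = [−a₁, a₁]` of normalised spins lies in the OPEN interval `(−1, 1)`
of admissible centres — the only use of the strict gap `a₁ < 1`, as
`Negative.bulkCaptureFamily_false_without_spinGap` demands — and `ρ₀ = 1` is admissible at every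
centre (`one_mem_Ioo_of_abs_lt_one`). Cover `K` by the claim's spin balls, extract a finite subcover
`t`, take `max s`, `max δ` over `t` (independent of `(M, η)`) and, per `(M, η)`, `min ε`. A spin
`|a| ≤ a₁ M` has `a/M ∈ K`, hence lies in the ball of some centre `χ₀ ∈ t`; the local body applies at
`r₀ = M = 1 · M ∈ (r₋, r₊)` (`Negative.mem_Ioo_rMinus_rPlus`, `|a| < M` by
`Negative.isSubextremal_of_spin_le`), its hypotheses following from the common ones by the
`(s, δ)`-monotonicity of the data distance
(`NearExtremalKappaCapture.Negative.dataWeightedSobolevEDist_mono`), and its all-orders convergence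
is instantiated at `k = 2`.
-/

-- the doubled `FinalStateConjecture.FinalStateConjecture` path component trips dupNamespace
set_option linter.dupNamespace false

noncomputable section

open Set Filter Topology Function
open scoped Manifold ContDiff ENNReal Topology
open Literature.Geometry.Lorentzian
open Summit.FinalStateConjecture.FinalStateConjecture.Theorems.BulkKerrCapture
open Summit.FinalStateConjecture.FinalStateConjecture.Theses.PhaseMixingCapture (BulkKerrCaptureC2)

namespace Summit.FinalStateConjecture.FinalStateConjecture.Theorems

namespace BulkKerrCaptureC2Port

/-- The unit normalised inner radius `ρ₀ = 1` is admissible at every sub-extremal normalised centre: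
`1 ∈ (1 − √(1 − χ²), 1 + √(1 − χ²))` for `|χ| < 1`. [folklore] -/
theorem one_mem_Ioo_of_abs_lt_one {χ : ℝ} (hχ : |χ| < 1) :
    (1 : ℝ) ∈ Set.Ioo (1 - √(1 - χ ^ 2)) (1 + √(1 - χ ^ 2)) := by
  have hpos : 0 < √(1 - χ ^ 2) := by
    apply Real.sqrt_pos.2
    have h1 : χ ^ 2 < 1 := (sq_lt_one_iff_abs_lt_one χ).2 hχ
    linarith
  exact ⟨by linarith, by linarith⟩

end BulkKerrCaptureC2Port

open BulkKerrCaptureC2Port in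
/-- **Registered stub `stub_c2Far_of_allOrdersBody` of line `SketchStandalone`
(`all-orders-lebesgue-port`) for crux `BulkKerrCaptureC2`.** The body of the claim-tagged Literature
fact `hintz_kerr_stability_subextremal_cauchy_allOrders` (VERBATIM, at all instances of the two
`Prop`-classes) implies the crux in its far form (the right-hand side of the tree lemma
`PhaseMixingCaptureCaptureSuffices.bulkKerrCaptureC2_iff`; the skeleton's composition applies `.2` of
that `iff`): Lebesgue number of a finite subcover of
`[−a₁, a₁] ⊂ (−1, 1)` by the claim's spin balls at `ρ₀ = 1`, `max s`, `max δ`, `min ε`,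
`(s, δ)`-monotonicity of the data distance, `k := 2`; see the module docstring. An implication between
two explicit statements — nothing is asserted about Hintz's claim itself. [folklore] -/
theorem stub_c2Far_of_allOrdersBody :
    (∀ [Kerr.Facts] [Kerr.SliceFacts],
      ∀ χ₀ : ℝ, |χ₀| < 1 → ∀ ρ₀ ∈ Set.Ioo (1 - √(1 - χ₀ ^ 2)) (1 + √(1 - χ₀ ^ 2)),
        ∃ (s : ℕ) (δ : ℝ), ∃ ς > (0 : ℝ), ∀ (M : ℝ) (hM : 0 < M), ∀ η > (0 : ℝ), ∃ ε > (0 : ℝ),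
          ∀ a r₀ : ℝ, |a / M - χ₀| < ς → r₀ = ρ₀ * M →
            r₀ ∈ Set.Ioo (Kerr.rMinus M a) (Kerr.rPlus M a) →
            ∀ (D : InitialDataSet 𝓘(ℝ, E3) (Kerr.slice a r₀)) [D.metric.HasLeviCivita],
              D.IsVacuumConstraintSolution →
              (∀ s' : ℕ,
                InitialDataSet.dataWeightedSobolevEDist s' δ D (Kerr.data M a r₀ hM.le) < ⊤) →
              InitialDataSet.dataWeightedSobolevEDist s δ D (Kerr.data M a r₀ hM.le) <
                ENNReal.ofReal ε →
              ∀ 𝒟 : VacuumCauchyDevelopment D, 𝒟.IsMaximal →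
                ∃ (M' a' : ℝ) (𝒟oc : Set 𝒟.carrier), Kerr.IsSubextremal M' a' ∧
                  |M' - M| + |a' - a| ≤ η ∧
                  𝒟.HasCompleteFutureNullInfinityFar ∧
                  ∀ k : ℕ, 𝒟.toSpacetime.ConvergesToKerr 𝒟oc M' a' k) →
    ∀ [Kerr.Facts] [Kerr.SliceFacts], ∀ a₁ : ℝ, a₁ < 1 → ∃ (s : ℕ) (δ : ℝ),
      ∀ (M : ℝ) (hM : 0 < M), ∀ η > (0 : ℝ), ∃ ε > (0 : ℝ), ∀ a : ℝ, |a| ≤ a₁ * M →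
        ∀ (D : InitialDataSet 𝓘(ℝ, E3) (Kerr.slice a M)) [D.metric.HasLeviCivita],
          D.IsVacuumConstraintSolution →
          (∀ s' : ℕ,
            InitialDataSet.dataWeightedSobolevEDist s' δ D (Kerr.data M a M hM.le) < ⊤) →
          InitialDataSet.dataWeightedSobolevEDist s δ D (Kerr.data M a M hM.le) <
            ENNReal.ofReal ε →
          ∀ 𝒟 : VacuumCauchyDevelopment D, 𝒟.IsMaximal →
            ∃ (M' a' : ℝ) (𝒟oc : Set 𝒟.carrier), Kerr.IsSubextremal M' a' ∧
              𝒟.HasCompleteFutureNullInfinityFar ∧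
              𝒟.toSpacetime.ConvergesToKerr 𝒟oc M' a' 2 ∧ |M' - M| + |a' - a| ≤ η := by
  intro hclaim instF instS a₁ ha₁
  classical
  -- empty spin range
  rcases lt_or_ge a₁ 0 with hneg | hnn
  · exact ⟨0, 0, fun M hM η _ ↦ ⟨1, one_pos, fun a ha ↦
      (Negative.no_spin_of_neg hneg hM ha).elim⟩⟩
  -- the compact segment of normalised spins lies in the open interval of admissible centres
  set K : Set ℝ := Icc (-a₁) a₁ with hK
  have hKc : IsCompact K := isCompact_Icc
  have hKsub : ∀ χ ∈ K, |χ| < 1 := fun χ hχ ↦ by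
    rw [hK, mem_Icc] at hχ
    exact abs_lt.2 ⟨by linarith [hχ.1], by linarith [hχ.2]⟩
  -- local data of the claim at every centre of `K`, inner radius `ρ₀ = 1`
  choose! s δ ς hς hcap using
    fun χ (hχ : χ ∈ K) ↦ hclaim χ (hKsub χ hχ) 1 (one_mem_Ioo_of_abs_lt_one (hKsub χ hχ))
  -- finite subcover of `K` by the spin balls
  have hcover : K ⊆ ⋃ χ ∈ K, Metric.ball χ (ς χ) := fun χ hχ ↦
    mem_biUnion hχ (Metric.mem_ball_self (hς χ hχ))
  obtain ⟨t, htK, htfin, hsub⟩ :=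
    hKc.elim_finite_subcover_image (fun χ _ ↦ Metric.isOpen_ball) hcover
  have hKne : K.Nonempty := ⟨0, by rw [hK, mem_Icc]; exact ⟨by linarith, hnn⟩⟩
  have htne : t.Nonempty := by
    obtain ⟨x, hx⟩ := hKne
    have hx' := hsub hx
    simp only [mem_iUnion] at hx'
    obtain ⟨i, hi, -⟩ := hx'
    exact ⟨i, hi⟩
  -- exponents uniform over the subcover (independent of the mass and the tolerance)
  obtain ⟨iS, -, hsmax⟩ := t.exists_max_image s htfin htne
  obtain ⟨iD, -, hdmax⟩ := t.exists_max_image δ htfin htne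
  refine ⟨s iS, δ iD, fun M hM η hη ↦ ?_⟩
  -- per mass and tolerance: one basin over the subcover
  choose! ε hε hbody using fun χ (hχ : χ ∈ t) ↦ hcap χ (htK hχ) M hM η hη
  obtain ⟨iE, hiEt, hemin⟩ := t.exists_min_image ε htfin htne
  refine ⟨ε iE, hε iE hiEt, fun a ha D _ hvac hcon hdist 𝒟 hmax ↦ ?_⟩
  -- locate the normalised spin in the cover
  have hχK : a / M ∈ K := by
    rw [hK, mem_Icc, ← abs_le, abs_div, abs_of_pos hM, div_le_iff₀ hM]
    exact ha
  have ha' := hsub hχK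
  simp only [mem_iUnion] at ha'
  obtain ⟨χ₀, hχ₀t, hball⟩ := ha'
  have hnear : |a / M - χ₀| < ς χ₀ := by simpa [Metric.mem_ball, Real.dist_eq] using hball
  have halt : Kerr.IsSubextremal M a := Negative.isSubextremal_of_spin_le ha₁ hM ha
  -- the common hypotheses imply the local ones (monotonicity in `(s, δ)`)
  have hmono_con : ∀ s' : ℕ,
      InitialDataSet.dataWeightedSobolevEDist s' (δ χ₀) D (Kerr.data M a M hM.le) < ⊤ :=
    fun s' ↦ lt_of_le_of_lt
      (NearExtremalKappaCapture.Negative.dataWeightedSobolevEDist_mono le_rfl (hdmax χ₀ hχ₀t) D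
        (Kerr.data M a M hM.le)) (hcon s')
  have hmono_dist : InitialDataSet.dataWeightedSobolevEDist (s χ₀) (δ χ₀) D
      (Kerr.data M a M hM.le) < ENNReal.ofReal (ε χ₀) :=
    lt_of_le_of_lt
      (NearExtremalKappaCapture.Negative.dataWeightedSobolevEDist_mono (hsmax χ₀ hχ₀t)
        (hdmax χ₀ hχ₀t) D (Kerr.data M a M hM.le))
      (hdist.trans_le (ENNReal.ofReal_le_ofReal (hemin χ₀ hχ₀t)))
  -- the local body at the centre `χ₀`, inner radius `M = 1 · M`, order `k = 2`
  obtain ⟨M', a', 𝒟oc, hsub', hpar, hfar, hconv⟩ :=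
    hbody χ₀ hχ₀t a M hnear (by ring) (Negative.mem_Ioo_rMinus_rPlus halt) D hvac hmono_con
      hmono_dist 𝒟 hmax
  exact ⟨M', a', 𝒟oc, hsub', hfar, hconv 2, hpar⟩

/-- **The crux modulo the claim (conditional closing shape, body form).** The body of
`hintz_kerr_stability_subextremal_cauchy_allOrders` implies `BulkKerrCaptureC2` BY NAME
(`PhaseMixingCaptureCaptureSuffices.bulkKerrCaptureC2_iff` after the stub). HONEST STATUS: CONDITIONAL on Hintz's unrefereed claim
(its hypothesis); it does not close stmt-FinalStateConjecture-14985 by itself — the item closes only by a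
`_holds` discharge of the named claim, whose statement unfolds to this hypothesis. [folklore] -/
theorem bulkKerrCaptureC2_of_allOrdersBody
    (hclaim : ∀ [Kerr.Facts] [Kerr.SliceFacts],
      ∀ χ₀ : ℝ, |χ₀| < 1 → ∀ ρ₀ ∈ Set.Ioo (1 - √(1 - χ₀ ^ 2)) (1 + √(1 - χ₀ ^ 2)),
        ∃ (s : ℕ) (δ : ℝ), ∃ ς > (0 : ℝ), ∀ (M : ℝ) (hM : 0 < M), ∀ η > (0 : ℝ), ∃ ε > (0 : ℝ),
          ∀ a r₀ : ℝ, |a / M - χ₀| < ς → r₀ = ρ₀ * M →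
            r₀ ∈ Set.Ioo (Kerr.rMinus M a) (Kerr.rPlus M a) →
            ∀ (D : InitialDataSet 𝓘(ℝ, E3) (Kerr.slice a r₀)) [D.metric.HasLeviCivita],
              D.IsVacuumConstraintSolution →
              (∀ s' : ℕ,
                InitialDataSet.dataWeightedSobolevEDist s' δ D (Kerr.data M a r₀ hM.le) < ⊤) →
              InitialDataSet.dataWeightedSobolevEDist s δ D (Kerr.data M a r₀ hM.le) <
                ENNReal.ofReal ε →
              ∀ 𝒟 : VacuumCauchyDevelopment D, 𝒟.IsMaximal →
                ∃ (M' a' : ℝ) (𝒟oc : Set 𝒟.carrier), Kerr.IsSubextremal M' a' ∧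
                  |M' - M| + |a' - a| ≤ η ∧
                  𝒟.HasCompleteFutureNullInfinityFar ∧
                  ∀ k : ℕ, 𝒟.toSpacetime.ConvergesToKerr 𝒟oc M' a' k) :
    BulkKerrCaptureC2 :=
  PhaseMixingCaptureCaptureSuffices.bulkKerrCaptureC2_iff.2 (stub_c2Far_of_allOrdersBody hclaim)

end Summit.FinalStateConjecture.FinalStateConjecture.Theorems

end
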